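import Literature.Analysis.FluidPDE.CompressibleEulerPrimitiveForm
import Literature.Analysis.FunctionSpaces.TorusLerayHelmholtz
import Literature.Analysis.FunctionSpaces.TorusClassicalNSUniqueness
import HarnessLib

/-!
# The symmetrisable form of the Euler system of a monatomic fluid and the equations for the
# difference of two solutions

Analysis/FluidPDE support file (everything proved), layer L0b of the programme to discharge
`Literature.Analysis.FluidPDE.CompressibleEulerLocalWellPosedness` (Majda 1984, Ch. 2,
Thms 2.1–2.2). For the athermal monatomic law `EulerEOS.monatomicExcess ζ f` (`p = ρϑζ(ρ) =
ϑ h(ρ)`, `h(s) = sζ(s)`, `e = 3ϑ/2`) the pressure gradient of the primitive Euler equation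
(`IsPrimitiveEulerSolutionOn.euler`, `CompressibleEulerPrimitiveForm.lean`) expands by the
chain rule as `ρ⁻¹∇p(ρ,ϑ) = (ϑh'(ρ)/ρ) ∇ρ + ζ(ρ) ∇ϑ`, which exhibits the primitive system as
the quasilinear SYMMETRISABLE system of Majda 1984, Ch. 1 (symmetriser
`diag(ϑh'(ρ)/ρ, ρI, 3ρ/(2ϑ))`, positive iff `h' = (ρζ)' > 0`):

  `∂ₜρ + u·∇ρ + ρ div u = 0`, `∂ₜu + (u·∇)u + (ϑh'(ρ)/ρ)∇ρ + ζ(ρ)∇ϑ = 0`,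
  `∂ₜϑ + u·∇ϑ + (2/3)ϑζ(ρ) div u = 0`.

* `partialDeriv_comp_deriv`, `gradient_comp_deriv`, `gradient_fun_mul` — chain and product
  rules for torus gradients (local twins of `FluidPDE.partialDeriv_comp_apply` /
  `FluidPDE.gradient_mul` of the heat-equation files, which this file must not import);
* `gradient_pressure_monatomicExcess` — `∇[p(ρ,ϑ)] = ϑh'(ρ) ∇ρ + h(ρ) ∇ϑ`;
* `IsPrimitiveEulerSolutionOn.euler_monatomicExcess` / `.of_symmetric_monatomicExcess` — the
  Euler equation of a primitive solution in the expanded form above, and the constructor of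
  primitive (hence classical) solutions from the three displayed equations;
* `IsPrimitiveEulerSolutionOn.continuity_sub`, `.euler_sub`, `.temperature_sub` — for TWO
  primitive solutions on the same time set, the differences `(ρ₁-ρ₂, u₁-u₂, ϑ₁-ϑ₂)` solve the
  LINEARISED system at the first solution (`CompressibleEulerLinearizedEnergy.lean`: `v = u₁`,
  `a = ϑ₁h'(ρ₁)/ρ₁`, `b = ζ(ρ₁)`, `c = ρ₁`, `g = (2/3)ϑ₁ζ(ρ₁)`) with the explicit zeroth-order
  residuals `R₁ = -(w·∇ρ₂ + r div u₂)`, `R₂ = -((w·∇)u₂ + (a₁-a₂)∇ρ₂ + (b₁-b₂)∇ϑ₂)`,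
  `R₃ = -(w·∇ϑ₂ + (g₁-g₂) div u₂)` (Dafermos 2005, (5.1.18); Majda 1984, (2.12)) — the input
  of the uniqueness theorem and of the contraction step of the iteration scheme.

## References

* A. Majda, *Compressible Fluid Flow and Systems of Conservation Laws in Several Space
  Variables*, Appl. Math. Sci. 53, Springer 1984, Ch. 1 (the Euler equations as a
  symmetrisable system), Ch. 2 §2.1 ((2.12): the equation for the difference of iterates).
  [`Majda1984`]
* C. M. Dafermos, *Hyperbolic Conservation Laws in Continuum Physics*, 2nd ed. (2005), §5.1,
  (5.1.18). [`Dafermos2005`]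
-/

noncomputable section

open Set Function Filter
open scoped ContDiff _root_.Topology InnerProductSpace

namespace Literature.Analysis.FluidPDE

namespace CompressibleEuler

open Literature.Analysis.FunctionSpaces

/-! ## Chain and product rules for torus gradients -/

section Calculus

variable {d : Type*} [Fintype d] [DecidableEq d]

/-- **Chain rule along coordinate lines**: `∂ᵢ(φ ∘ w)(x) = φ'(w x) ∂ᵢw(x)` for a `C¹` scalar `w`
on the torus and a differentiable `φ : ℝ → ℝ` (twin of `FluidPDE.partialDeriv_comp_apply`).
[folklore] -/
theorem partialDeriv_comp_deriv {φ : ℝ → ℝ} (hφ : Differentiable ℝ φ) {w : UnitAddTorus d → ℝ}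
    (hw : FunctionSpaces.Torus.IsContDiff 1 w) (i : d) (x : UnitAddTorus d) :
    FunctionSpaces.Torus.partialDeriv i (fun z => φ (w z)) x =
      deriv φ (w x) * FunctionSpaces.Torus.partialDeriv i w x := by
  have hin := FunctionSpaces.Torus.hasDerivAt_comp_add_proj_smul hw x (EuclideanSpace.single i (1 : ℝ)) 0
  have hx0 : x + FunctionSpaces.Torus.proj ((0 : ℝ) • EuclideanSpace.single i (1 : ℝ)) = x := by
    rw [zero_smul, FunctionSpaces.Torus.proj_zero, add_zero]
  rw [hx0] at hin
  have h := ((hφ (w x)).hasDerivAt).comp_of_eq (0 : ℝ) hin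
    (by simp only [zero_smul, FunctionSpaces.Torus.proj_zero, add_zero])
  change deriv (fun t : ℝ => φ (w (x + FunctionSpaces.Torus.proj (t • EuclideanSpace.single i (1 : ℝ))))) 0 =
    deriv φ (w x) * deriv (fun t : ℝ => w (x + FunctionSpaces.Torus.proj (t • EuclideanSpace.single i (1 : ℝ)))) 0
  rw [hin.deriv]
  exact h.deriv

/-- **Chain rule for the torus gradient**: `∇(φ ∘ w)(x) = φ'(w x) • ∇w(x)`. [folklore] -/
theorem gradient_comp_deriv {φ : ℝ → ℝ} (hφ : Differentiable ℝ φ) (hφ1 : ContDiff ℝ 1 φ)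
    {w : UnitAddTorus d → ℝ} (hw : FunctionSpaces.Torus.IsContDiff 1 w) (x : UnitAddTorus d) :
    FunctionSpaces.Torus.gradient (fun z => φ (w z)) x = deriv φ (w x) • FunctionSpaces.Torus.gradient w x := by
  have h1 : FunctionSpaces.Torus.IsContDiff 1 (fun z => φ (w z)) := hφ1.comp hw
  rw [FunctionSpaces.Torus.gradient_eq_sum_partialDeriv h1, FunctionSpaces.Torus.gradient_eq_sum_partialDeriv hw,
    Finset.smul_sum]
  refine Finset.sum_congr rfl fun i _ => ?_
  rw [partialDeriv_comp_deriv hφ hw i x, smul_smul]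

/-- **Product rule for the torus gradient**: `∇(a b)(x) = a x • ∇b(x) + b x • ∇a(x)` — verbatim
twin of `Torus.gradient_mul` (`PassiveScalarProofs.lean`), kept as a deprecated alias (librarian
dedup-01930). [folklore] -/
@[deprecated Torus.gradient_mul (since := "2026-08-16")]
alias gradient_fun_mul := Torus.gradient_mul

omit [DecidableEq d] in
/-- One-sided time derivatives of differences of jointly smooth fields. [folklore] -/
theorem timeDerivWithin_fun_sub {F : Type*} [NormedAddCommGroup F] [NormedSpace ℝ F] {S : Set ℝ}
    {p q : ℝ → UnitAddTorus d → F} (hp : FunctionSpaces.Torus.IsSmoothSpaceTimeOn S p)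
    (hq : FunctionSpaces.Torus.IsSmoothSpaceTimeOn S q) (hS : UniqueDiffOn ℝ S) {t : ℝ} (ht : t ∈ S)
    (x : UnitAddTorus d) :
    FunctionSpaces.Torus.timeDerivWithin S (fun s y => p s y - q s y) t x =
      FunctionSpaces.Torus.timeDerivWithin S p t x - FunctionSpaces.Torus.timeDerivWithin S q t x :=
  ((hp.hasDerivWithinAt_slice ht x).sub (hq.hasDerivWithinAt_slice ht x)).derivWithin (hS t ht)

end Calculus

/-! ## The pressure gradient of the monatomic athermal law -/

section Monatomic

variable {ζ f : ℝ → ℝ}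

/-- `h(s) = s ζ(s)` is smooth when `ζ` is. [folklore] -/
theorem contDiff_mul_zeta (hζ : ContDiff ℝ ∞ ζ) : ContDiff ℝ ∞ (fun s : ℝ => s * ζ s) :=
  contDiff_id.mul hζ

/-- `h' = (s ζ(s))'` is smooth when `ζ` is. [folklore] -/
theorem contDiff_deriv_mul_zeta (hζ : ContDiff ℝ ∞ ζ) : ContDiff ℝ ∞ (deriv fun s : ℝ => s * ζ s) :=
  (contDiff_infty_iff_deriv.1 (contDiff_mul_zeta hζ)).2

/-- **The pressure gradient of `p = ρϑζ(ρ) = ϑ h(ρ)`**: for `C¹` torus functions `ρ, ϑ`,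
`∇[p(ρ, ϑ)](x) = (ϑ x · h'(ρ x)) • ∇ρ(x) + h(ρ x) • ∇ϑ(x)`, `h(s) = sζ(s)` (product and chain
rules). [cite: Majda1984, Ch. 1] -/
theorem gradient_pressure_monatomicExcess (hζ : ContDiff ℝ ∞ ζ) {ρ ϑ : UnitAddTorus (Fin 3) → ℝ}
    (hρ : FunctionSpaces.Torus.IsContDiff 1 ρ) (hϑ : FunctionSpaces.Torus.IsContDiff 1 ϑ)
    (x : UnitAddTorus (Fin 3)) :
    FunctionSpaces.Torus.gradient (fun y => (EulerEOS.monatomicExcess ζ f).p (ρ y) (ϑ y)) x =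
      (ϑ x * deriv (fun s : ℝ => s * ζ s) (ρ x)) • FunctionSpaces.Torus.gradient ρ x +
        (ρ x * ζ (ρ x)) • FunctionSpaces.Torus.gradient ϑ x := by
  have hh := contDiff_mul_zeta hζ
  have hh1 : ContDiff ℝ 1 (fun s : ℝ => s * ζ s) := hh.of_le (by simp)
  have hhd : Differentiable ℝ (fun s : ℝ => s * ζ s) := hh1.differentiable one_ne_zero
  have hcomp : FunctionSpaces.Torus.IsContDiff 1 (fun y => ρ y * ζ (ρ y)) := by
    change ContDiff ℝ 1 ((fun s : ℝ => s * ζ s) ∘ FunctionSpaces.Torus.lift ρ)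
    exact hh1.comp hρ
  have hp : (fun y => (EulerEOS.monatomicExcess ζ f).p (ρ y) (ϑ y)) = fun y => ϑ y * (ρ y * ζ (ρ y)) := by
    funext y
    simp only [EulerEOS.monatomicExcess]
    ring
  rw [hp, Torus.gradient_mul hϑ hcomp x,
    gradient_comp_deriv (φ := fun s : ℝ => s * ζ s) hhd hh1 hρ x, smul_smul]

variable {S : Set ℝ} {ρ : ℝ → UnitAddTorus (Fin 3) → ℝ}
  {u : ℝ → UnitAddTorus (Fin 3) → EuclideanSpace ℝ (Fin 3)} {ϑ : ℝ → UnitAddTorus (Fin 3) → ℝ}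

/-- `ρ⁻¹ ∇[p(ρ,ϑ)] = (ϑh'(ρ)/ρ) ∇ρ + ζ(ρ) ∇ϑ` along smooth fields with `ρ ≠ 0`. [cite: Majda1984, Ch. 1] -/
theorem inv_smul_gradient_pressure_monatomicExcess (hζ : ContDiff ℝ ∞ ζ)
    {ρ ϑ : UnitAddTorus (Fin 3) → ℝ} (hρ : FunctionSpaces.Torus.IsContDiff 1 ρ)
    (hϑ : FunctionSpaces.Torus.IsContDiff 1 ϑ) (x : UnitAddTorus (Fin 3)) (hρ0 : ρ x ≠ 0) :
    (ρ x)⁻¹ • FunctionSpaces.Torus.gradient (fun y => (EulerEOS.monatomicExcess ζ f).p (ρ y) (ϑ y)) x =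
      (ϑ x * deriv (fun s : ℝ => s * ζ s) (ρ x) / ρ x) • FunctionSpaces.Torus.gradient ρ x +
        ζ (ρ x) • FunctionSpaces.Torus.gradient ϑ x := by
  rw [gradient_pressure_monatomicExcess hζ hρ hϑ x, smul_add, smul_smul, smul_smul]
  congr 1
  · rw [div_eq_inv_mul]
  · rw [← mul_assoc, inv_mul_cancel₀ hρ0, one_mul]

/-- **The Euler equation of a primitive solution, symmetrisable form**:
`∂ₜu + ∑ᵢuᵢ∂ᵢu + (ϑh'(ρ)/ρ) ∇ρ + ζ(ρ) ∇ϑ = 0` for the law `p = ρϑζ(ρ)` (Majda 1984, Ch. 1).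
[cite: Majda1984, Ch. 1] -/
theorem IsPrimitiveEulerSolutionOn.euler_monatomicExcess (hζ : ContDiff ℝ ∞ ζ)
    (h : IsPrimitiveEulerSolutionOn (EulerEOS.monatomicExcess ζ f) S ρ u ϑ) {t : ℝ} (ht : t ∈ S)
    (x : UnitAddTorus (Fin 3)) :
    FunctionSpaces.Torus.timeDerivWithin S u t x +
        (∑ i, u t x i • FunctionSpaces.Torus.partialDeriv i (u t) x) +
        (ϑ t x * deriv (fun s : ℝ => s * ζ s) (ρ t x) / ρ t x) • FunctionSpaces.Torus.gradient (ρ t) x +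
        ζ (ρ t x) • FunctionSpaces.Torus.gradient (ϑ t) x = 0 := by
  have hρ1 : FunctionSpaces.Torus.IsContDiff 1 (ρ t) := (h.smooth_density.isSmooth_slice ht).isContDiff (by simp)
  have hϑ1 : FunctionSpaces.Torus.IsContDiff 1 (ϑ t) :=
    (h.smooth_temperature.isSmooth_slice ht).isContDiff (by simp)
  have key := h.euler t ht x
  rw [inv_smul_gradient_pressure_monatomicExcess hζ hρ1 hϑ1 x (h.density_pos t ht x).ne'] at key
  rw [← key]
  abel

/-- **Primitive solutions from the symmetrisable system.** Jointly smooth `ρ, u, ϑ` on a time set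
of unique differentiability with `ρ, ϑ > 0` satisfying the three equations of the symmetrisable
form (continuity, expanded Euler, temperature) form a primitive solution for
`monatomicExcess ζ f` — hence a classical one (`IsPrimitiveEulerSolutionOn.classical`). This is
the form in which the iteration scheme of the local existence theorem produces solutions.
[cite: Majda1984, Ch. 2 §2.1 Thm 2.1] -/
theorem IsPrimitiveEulerSolutionOn.of_symmetric_monatomicExcess (hζ : ContDiff ℝ ∞ ζ) (hS : UniqueDiffOn ℝ S)
    (hρ : FunctionSpaces.Torus.IsSmoothSpaceTimeOn S ρ) (hu : FunctionSpaces.Torus.IsSmoothSpaceTimeOn S u)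
    (hϑ : FunctionSpaces.Torus.IsSmoothSpaceTimeOn S ϑ)
    (hρpos : ∀ t ∈ S, ∀ x, 0 < ρ t x) (hϑpos : ∀ t ∈ S, ∀ x, 0 < ϑ t x)
    (hc : ∀ t ∈ S, ∀ x, FunctionSpaces.Torus.timeDerivWithin S ρ t x +
        (∑ i, u t x i * FunctionSpaces.Torus.partialDeriv i (ρ t) x) +
      ρ t x * FunctionSpaces.Torus.divergence (u t) x = 0)
    (heu : ∀ t ∈ S, ∀ x, FunctionSpaces.Torus.timeDerivWithin S u t x +
        (∑ i, u t x i • FunctionSpaces.Torus.partialDeriv i (u t) x) +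
        (ϑ t x * deriv (fun s : ℝ => s * ζ s) (ρ t x) / ρ t x) • FunctionSpaces.Torus.gradient (ρ t) x +
        ζ (ρ t x) • FunctionSpaces.Torus.gradient (ϑ t) x = 0)
    (hte : ∀ t ∈ S, ∀ x, FunctionSpaces.Torus.timeDerivWithin S ϑ t x +
        (∑ i, u t x i * FunctionSpaces.Torus.partialDeriv i (ϑ t) x) +
        2 / 3 * (ϑ t x * ζ (ρ t x)) * FunctionSpaces.Torus.divergence (u t) x = 0) :
    IsPrimitiveEulerSolutionOn (EulerEOS.monatomicExcess ζ f) S ρ u ϑ := by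
  refine IsPrimitiveEulerSolutionOn.of_monatomicExcess hS hρ hu hϑ hρpos hϑpos hc (fun t ht x => ?_) hte
  have hρ1 : FunctionSpaces.Torus.IsContDiff 1 (ρ t) := (hρ.isSmooth_slice ht).isContDiff (by simp)
  have hϑ1 : FunctionSpaces.Torus.IsContDiff 1 (ϑ t) := (hϑ.isSmooth_slice ht).isContDiff (by simp)
  rw [inv_smul_gradient_pressure_monatomicExcess hζ hρ1 hϑ1 x (hρpos t ht x).ne', ← heu t ht x]
  abel

/-! ## The linearised system solved by the difference of two solutions -/

variable {ρ₁ ρ₂ : ℝ → UnitAddTorus (Fin 3) → ℝ} {u₁ u₂ : ℝ → UnitAddTorus (Fin 3) → EuclideanSpace ℝ (Fin 3)}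
  {ϑ₁ ϑ₂ : ℝ → UnitAddTorus (Fin 3) → ℝ}

/-- **Continuity equation for the difference.** For two primitive solutions on `S`, with
`r = ρ₁ - ρ₂`, `w = u₁ - u₂`: `∂ₜr + ∑ᵢu₁ᵢ∂ᵢr + ρ₁ div w = -(∑ᵢ wᵢ∂ᵢρ₂ + r div u₂)`
(subtract the two continuity equations; Dafermos 2005, (5.1.18)). [cite: Majda1984, Ch. 2 §2.1 (2.12)] -/
theorem IsPrimitiveEulerSolutionOn.continuity_sub {eos : EulerEOS}
    (h₁ : IsPrimitiveEulerSolutionOn eos S ρ₁ u₁ ϑ₁) (h₂ : IsPrimitiveEulerSolutionOn eos S ρ₂ u₂ ϑ₂)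
    (hS : UniqueDiffOn ℝ S) {t : ℝ} (ht : t ∈ S) (x : UnitAddTorus (Fin 3)) :
    FunctionSpaces.Torus.timeDerivWithin S (fun s y => ρ₁ s y - ρ₂ s y) t x +
        (∑ i, u₁ t x i * FunctionSpaces.Torus.partialDeriv i (fun y => ρ₁ t y - ρ₂ t y) x) +
        ρ₁ t x * FunctionSpaces.Torus.divergence (fun y => u₁ t y - u₂ t y) x =
      -((∑ i, (u₁ t x i - u₂ t x i) * FunctionSpaces.Torus.partialDeriv i (ρ₂ t) x) +
        (ρ₁ t x - ρ₂ t x) * FunctionSpaces.Torus.divergence (u₂ t) x) := by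
  have hρ₁ : FunctionSpaces.Torus.IsContDiff 1 (ρ₁ t) := (h₁.smooth_density.isSmooth_slice ht).isContDiff (by simp)
  have hρ₂ : FunctionSpaces.Torus.IsContDiff 1 (ρ₂ t) := (h₂.smooth_density.isSmooth_slice ht).isContDiff (by simp)
  have hu₁ : FunctionSpaces.Torus.IsContDiff 1 (u₁ t) := (h₁.smooth_velocity.isSmooth_slice ht).isContDiff (by simp)
  have hu₂ : FunctionSpaces.Torus.IsContDiff 1 (u₂ t) := (h₂.smooth_velocity.isSmooth_slice ht).isContDiff (by simp)
  have e₁ := h₁.continuity t ht x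
  have e₂ := h₂.continuity t ht x
  rw [timeDerivWithin_fun_sub h₁.smooth_density h₂.smooth_density hS ht x,
    show (fun y => ρ₁ t y - ρ₂ t y) = ρ₁ t - ρ₂ t from rfl,
    show (fun y => u₁ t y - u₂ t y) = u₁ t - u₂ t from rfl,
    FunctionSpaces.Torus.divergence_sub hu₁ hu₂]
  simp only [FunctionSpaces.Torus.partialDeriv_sub hρ₁ hρ₂, Pi.sub_apply, mul_sub, sub_mul,
    Finset.sum_sub_distrib]
  linear_combination e₁ - e₂

/-- **Temperature equation for the difference.** For two primitive solutions of
`monatomicExcess ζ f` on `S`, with `θ = ϑ₁ - ϑ₂`, `w = u₁ - u₂`, `g = (2/3)ϑζ(ρ)`: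
`∂ₜθ + ∑ᵢu₁ᵢ∂ᵢθ + g₁ div w = -(∑ᵢ wᵢ∂ᵢϑ₂ + (g₁ - g₂) div u₂)`.
[cite: Majda1984, Ch. 2 §2.1 (2.12)] -/
theorem IsPrimitiveEulerSolutionOn.temperature_sub
    (h₁ : IsPrimitiveEulerSolutionOn (EulerEOS.monatomicExcess ζ f) S ρ₁ u₁ ϑ₁)
    (h₂ : IsPrimitiveEulerSolutionOn (EulerEOS.monatomicExcess ζ f) S ρ₂ u₂ ϑ₂)
    (hS : UniqueDiffOn ℝ S) {t : ℝ} (ht : t ∈ S) (x : UnitAddTorus (Fin 3)) :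
    FunctionSpaces.Torus.timeDerivWithin S (fun s y => ϑ₁ s y - ϑ₂ s y) t x +
        (∑ i, u₁ t x i * FunctionSpaces.Torus.partialDeriv i (fun y => ϑ₁ t y - ϑ₂ t y) x) +
        2 / 3 * (ϑ₁ t x * ζ (ρ₁ t x)) * FunctionSpaces.Torus.divergence (fun y => u₁ t y - u₂ t y) x =
      -((∑ i, (u₁ t x i - u₂ t x i) * FunctionSpaces.Torus.partialDeriv i (ϑ₂ t) x) +
        (2 / 3 * (ϑ₁ t x * ζ (ρ₁ t x)) - 2 / 3 * (ϑ₂ t x * ζ (ρ₂ t x))) *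
          FunctionSpaces.Torus.divergence (u₂ t) x) := by
  have hϑ₁ : FunctionSpaces.Torus.IsContDiff 1 (ϑ₁ t) :=
    (h₁.smooth_temperature.isSmooth_slice ht).isContDiff (by simp)
  have hϑ₂ : FunctionSpaces.Torus.IsContDiff 1 (ϑ₂ t) :=
    (h₂.smooth_temperature.isSmooth_slice ht).isContDiff (by simp)
  have hu₁ : FunctionSpaces.Torus.IsContDiff 1 (u₁ t) := (h₁.smooth_velocity.isSmooth_slice ht).isContDiff (by simp)
  have hu₂ : FunctionSpaces.Torus.IsContDiff 1 (u₂ t) := (h₂.smooth_velocity.isSmooth_slice ht).isContDiff (by simp)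
  have e₁ := h₁.temperature_eq hS ht x
  have e₂ := h₂.temperature_eq hS ht x
  rw [timeDerivWithin_fun_sub h₁.smooth_temperature h₂.smooth_temperature hS ht x,
    show (fun y => ϑ₁ t y - ϑ₂ t y) = ϑ₁ t - ϑ₂ t from rfl,
    show (fun y => u₁ t y - u₂ t y) = u₁ t - u₂ t from rfl,
    FunctionSpaces.Torus.divergence_sub hu₁ hu₂]
  simp only [FunctionSpaces.Torus.partialDeriv_sub hϑ₁ hϑ₂, Pi.sub_apply, mul_sub, sub_mul,
    Finset.sum_sub_distrib]
  linear_combination e₁ - e₂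

/-- **Euler equation for the difference.** For two primitive solutions of `monatomicExcess ζ f`
on `S`, with `r = ρ₁ - ρ₂`, `w = u₁ - u₂`, `θ = ϑ₁ - ϑ₂`, `a = ϑh'(ρ)/ρ`, `b = ζ(ρ)`:
`∂ₜw + ∑ᵢu₁ᵢ∂ᵢw + a₁∇r + b₁∇θ = -(∑ᵢwᵢ∂ᵢu₂ + (a₁ - a₂)∇ρ₂ + (b₁ - b₂)∇ϑ₂)`.
[cite: Majda1984, Ch. 2 §2.1 (2.12)] -/
theorem IsPrimitiveEulerSolutionOn.euler_sub (hζ : ContDiff ℝ ∞ ζ)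
    (h₁ : IsPrimitiveEulerSolutionOn (EulerEOS.monatomicExcess ζ f) S ρ₁ u₁ ϑ₁)
    (h₂ : IsPrimitiveEulerSolutionOn (EulerEOS.monatomicExcess ζ f) S ρ₂ u₂ ϑ₂)
    (hS : UniqueDiffOn ℝ S) {t : ℝ} (ht : t ∈ S) (x : UnitAddTorus (Fin 3)) :
    FunctionSpaces.Torus.timeDerivWithin S (fun s y => u₁ s y - u₂ s y) t x +
        (∑ i, u₁ t x i • FunctionSpaces.Torus.partialDeriv i (fun y => u₁ t y - u₂ t y) x) +
        (ϑ₁ t x * deriv (fun s : ℝ => s * ζ s) (ρ₁ t x) / ρ₁ t x) •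
          FunctionSpaces.Torus.gradient (fun y => ρ₁ t y - ρ₂ t y) x +
        ζ (ρ₁ t x) • FunctionSpaces.Torus.gradient (fun y => ϑ₁ t y - ϑ₂ t y) x =
      -((∑ i, (u₁ t x i - u₂ t x i) • FunctionSpaces.Torus.partialDeriv i (u₂ t) x) +
        (ϑ₁ t x * deriv (fun s : ℝ => s * ζ s) (ρ₁ t x) / ρ₁ t x -
            ϑ₂ t x * deriv (fun s : ℝ => s * ζ s) (ρ₂ t x) / ρ₂ t x) •
          FunctionSpaces.Torus.gradient (ρ₂ t) x +
        (ζ (ρ₁ t x) - ζ (ρ₂ t x)) • FunctionSpaces.Torus.gradient (ϑ₂ t) x) := by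
  have hρ₁ : FunctionSpaces.Torus.IsContDiff 1 (ρ₁ t) := (h₁.smooth_density.isSmooth_slice ht).isContDiff (by simp)
  have hρ₂ : FunctionSpaces.Torus.IsContDiff 1 (ρ₂ t) := (h₂.smooth_density.isSmooth_slice ht).isContDiff (by simp)
  have hϑ₁ : FunctionSpaces.Torus.IsContDiff 1 (ϑ₁ t) :=
    (h₁.smooth_temperature.isSmooth_slice ht).isContDiff (by simp)
  have hϑ₂ : FunctionSpaces.Torus.IsContDiff 1 (ϑ₂ t) :=
    (h₂.smooth_temperature.isSmooth_slice ht).isContDiff (by simp)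
  have hu₁ : FunctionSpaces.Torus.IsContDiff 1 (u₁ t) := (h₁.smooth_velocity.isSmooth_slice ht).isContDiff (by simp)
  have hu₂ : FunctionSpaces.Torus.IsContDiff 1 (u₂ t) := (h₂.smooth_velocity.isSmooth_slice ht).isContDiff (by simp)
  have e₁ := h₁.euler_monatomicExcess hζ ht x
  have e₂ := h₂.euler_monatomicExcess hζ ht x
  rw [timeDerivWithin_fun_sub h₁.smooth_velocity h₂.smooth_velocity hS ht x,
    show (fun y => u₁ t y - u₂ t y) = u₁ t - u₂ t from rfl,
    show (fun y => ρ₁ t y - ρ₂ t y) = ρ₁ t - ρ₂ t from rfl,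
    show (fun y => ϑ₁ t y - ϑ₂ t y) = ϑ₁ t - ϑ₂ t from rfl,
    FunctionSpaces.Torus.gradient_sub hρ₁ hρ₂, FunctionSpaces.Torus.gradient_sub hϑ₁ hϑ₂]
  simp only [FunctionSpaces.Torus.partialDeriv_sub hu₁ hu₂, Pi.sub_apply, smul_sub, sub_smul,
    Finset.sum_sub_distrib]
  rw [← sub_eq_zero]
  have key : FunctionSpaces.Torus.timeDerivWithin S u₁ t x +
        (∑ i, u₁ t x i • FunctionSpaces.Torus.partialDeriv i (u₁ t) x) +
        (ϑ₁ t x * deriv (fun s : ℝ => s * ζ s) (ρ₁ t x) / ρ₁ t x) • FunctionSpaces.Torus.gradient (ρ₁ t) x +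
        ζ (ρ₁ t x) • FunctionSpaces.Torus.gradient (ϑ₁ t) x -
      (FunctionSpaces.Torus.timeDerivWithin S u₂ t x +
        (∑ i, u₂ t x i • FunctionSpaces.Torus.partialDeriv i (u₂ t) x) +
        (ϑ₂ t x * deriv (fun s : ℝ => s * ζ s) (ρ₂ t x) / ρ₂ t x) • FunctionSpaces.Torus.gradient (ρ₂ t) x +
        ζ (ρ₂ t x) • FunctionSpaces.Torus.gradient (ϑ₂ t) x) = 0 := by
    rw [e₁, e₂, sub_zero]
  rw [← key]
  abel

end Monatomic

end CompressibleEuler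

end Literature.Analysis.FluidPDE

end
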